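import Literature.Computability.Cryptography.HallgrenTableCode
import Literature.Computability.Cryptography.HallgrenTrueCand
import Literature.Computability.Cryptography.HallgrenBlurredTable
import Literature.Computability.Cryptography.HallgrenCombCorrMass
import HarnessLib

/-!
# Hallgren's oracle table realises the blurred gap table of the principal cycle

Topic `Computability/Cryptography`; joins `HallgrenTableCode.lean` (the compact code `tabH` of the
integer walk table `tabVal`) to `HallgrenBlurredTable.lean` (the `BlurredGapTable` of a
`GiantStepCycle`, here the input's cycle `cycD`) — Jozsa 2003, §10 Prop. 36: the computed function
`h̃_N` has the level-set structure the Fourier sampling needs. We show that on `[0, 2^L)` the table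
values are GENUINE (valid reduced labels, small offsets; `genuine_tabVal`), so that the code `tabH`
separates exactly the level sets of the blurred table (`tabH_eq_iff`): the hypothesis `hrel` of
`HallgrenUnitBound.prob_cEst_harmonic_ge`. Theorem-and-definition file, no named facts.

## References

* R. Jozsa, arXiv:quant-ph/0302134 (2003), §9 Thm. 5, §10 Prop. 36. [Jozsa2003]
-/

noncomputable section

open scoped Classical

namespace Literature.Computability.Cryptography

namespace HallgrenGiantStep

open _root_.Computability Literature.Computability.Complexity Literature.NumberTheory.QuadraticFields
  Literature.NumberTheory.QuadraticFields.QuadIrr PeriodFinding HallgrenPost InfraPrimitives IntWalkOps GiantStepCycle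
  BlurredGapTable

variable (q : Polynomial ℕ) {x : List Bool} (hsf : Squarefree (decodeNat x)) (h2 : 2 ≤ decodeNat x)

/-! ### The data of the input -/

/-- The discriminant of the input. [folklore] -/
abbrev Dx (x : List Bool) : ℕ := Dof (decodeNat x)

/-- The cycle of the input (`cycD` at `d = decodeNat x`). [folklore] -/
abbrev cycX (hsf : Squarefree (decodeNat x)) (h2 : 2 ≤ decodeNat x) : GiantStepCycle (ℤ × ℤ) := cycD hsf h2 q x

include hsf h2

/-- The walk data of the input's cycle are the integer operations at the input's instance. [folklore] -/
theorem cycX_toWalkData : (cycX q hsf h2).toWalkData = hallgrenOps.toWalkData ((hallgrenW q).dOf x) :=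
  cycD_toWalkData hsf h2 q rfl

omit hsf h2 in
/-- The instance of the input. [folklore] -/
theorem hallgrenW_dOf : (hallgrenW q).dOf x = (Dx x, precOf (Dx x) (Tx q x) + (2 * x.length + 30)) := rfl

/-! ### Labels of the table are valid -/

omit hsf h2 in
/-- **The label of the table value is a valid label** (the walk only ever produces valid states). [cite: Jozsa2003, §9 Thm. 5] -/
theorem validL_tabVal (v : ℕ) : ValidL (Dx x) (tabVal q x v).1 := by
  unfold tabVal IntWalkOps.tableI IntWalkOps.finalI
  set d := (hallgrenW q).dOf x
  have h0 := hallgrenSpec.valid_descentFromI d (v : ℤ) ((hallgrenW q).N x) ((hallgrenW q).s₀ x) ((hallgrenW q).T x) 0 (Nat.zero_le _)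
  have h1 := hallgrenSpec.valid_iterate_finStepI d (v : ℤ) ((hallgrenW q).N x) _ h0.1 _ h0.2 (2 * (hallgrenW q).M x)
  exact h1.1

/-- **Genuine labels**: `1 ≤ P, Q`, and `P, Q < 2^{|x|+5}`. [cite: Jozsa2003, §6.1 Prop. 17] -/
theorem label_bounds (v : ℕ) :
    0 < (tabVal q x v).1.1 ∧ (tabVal q x v).1.1 < 2 ^ (x.length + 5) ∧ 0 < (tabVal q x v).1.2 ∧
      (tabVal q x v).1.2 < 2 ^ (x.length + 5) := by
  obtain ⟨hD, hD4⟩ := goodD_Dof hsf h2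
  have hval := validL_tabVal q v (x := x)
  rw [validL_iff ⟨hD, hD4⟩] at hval
  obtain ⟨-, hred⟩ := hval
  obtain ⟨h1, -, h3⟩ := IsReduced.size hred
  have hP : 0 < (tabVal q x v).1.1 := hred.P_pos
  have hQ : 0 < (tabVal q x v).1.2 := hred.1
  have h1' : (tabVal q x v).1.1.natAbs ≤ Dx x := h1
  have h3' : (tabVal q x v).1.2.natAbs ≤ 2 * Dx x + 1 := h3
  have hs : (Dx x).size ≤ x.length + 3 := size_Dof_le x
  have hDlt : Dx x < 2 ^ (x.length + 3) := lt_of_lt_of_le (Nat.lt_size_self _) (Nat.pow_le_pow_right (by norm_num) hs)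
  have hDz : ((Dx x : ℕ) : ℤ) < 2 ^ (x.length + 3) := by exact_mod_cast hDlt
  have e : (2 : ℤ) ^ (x.length + 5) = 2 ^ (x.length + 3) * 4 := by ring
  have hPle : (tabVal q x v).1.1 ≤ (Dx x : ℤ) := by
    have := Int.le_natAbs (a := (tabVal q x v).1.1); omega
  have hQle : (tabVal q x v).1.2 ≤ 2 * (Dx x : ℤ) + 1 := by
    have := Int.le_natAbs (a := (tabVal q x v).1.2); omega
  refine ⟨hP, ?_, hQ, ?_⟩
  · rw [e]; linarith
  · rw [e]; linarith

/-! ### Offsets of the table are small -/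

/-- **The offset of the table value** is `v − ⌈N d̂(v/N)⌉` for the rational walk of the cycle. [folklore] -/
theorem tabVal_snd (v : ℕ) : (tabVal q x v).2 = (v : ℤ) - ⌈((hallgrenW q).N x : ℚ) *
    ((cycX q hsf h2).final ((v : ℚ) / (hallgrenW q).N x) ((hallgrenW q).s₀ x) ((hallgrenW q).T x) (2 * (hallgrenW q).M x)).2⌉ := by
  have hN : 0 < (hallgrenW q).N x := lt_of_lt_of_le (by norm_num) (hallgrenW_N_ge q x)
  unfold tabVal
  rw [hallgrenOps.tableI_eq_table ((hallgrenW q).dOf x) hN, ← cycX_toWalkData q hsf h2]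
  rfl

/-- **Offsets are small**: `0 ≤ v − ⌈N d̂⌉ < 2^{3|x| + 31}` for `v/N ≤ 2^T · 7/8`. [cite: Jozsa2003, §10 Prop. 36] -/
theorem offset_bounds {v : ℕ} (hv : ((v : ℝ) / (hallgrenW q).N x) ≤ (2 : ℝ) ^ Tx q x * (7 / 8)) :
    0 ≤ (tabVal q x v).2 ∧ (tabVal q x v).2 < 2 ^ (3 * x.length + 31) := by
  obtain ⟨hD, hD4⟩ := goodD_Dof hsf h2
  set C := cycX q hsf h2 with hCdef
  set Nn := (hallgrenW q).N x with hNn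
  have hN4096 : 4096 ≤ Nn := hallgrenW_N_ge q x
  have hNpos : 0 < Nn := lt_of_lt_of_le (by norm_num) hN4096
  have hNq : (0 : ℚ) < Nn := by exact_mod_cast hNpos
  have hNr : (0 : ℝ) < Nn := by exact_mod_cast hNpos
  set Tv := Tx q x with hTv
  have hT : (hallgrenW q).T x = Tv := rfl
  set y : ℚ := (v : ℚ) / Nn with hy
  have hy0 : 0 ≤ y := by positivity
  have hs₀ : (hallgrenW q).s₀ x = s0Of (Dx x) := rfl
  have hM : (hallgrenW q).M x = MOf (Dx x) Tv := rfl
  rw [tabVal_snd q hsf h2 v, hT, hM, hs₀]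
  set dh := (C.final y (s0Of (Dx x)) Tv (2 * MOf (Dx x) Tv)).2 with hdh
  -- upper: `d̂ ≤ y`
  have hup : dh ≤ y := C.final_le hy0 _ _ _
  -- lower: `d̂ > y − G − 2E − η`
  have hyT : (y : ℝ) ≤ (C.dbl (s0Of (Dx x)) Tv).2 := by
    refine reach_ok' hD hD4 Tv _ ?_
    have : ((y : ℚ) : ℝ) = (v : ℝ) / Nn := by rw [hy]; push_cast; rfl
    rw [this]; exact hv
  have hres : C.Res (s0Of (Dx x)) Tv < (MOf (Dx x) Tv) * (C.L - 2 * C.η) := res_ok hD hD4 Tv _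
  obtain ⟨m, -, hdm, hPm, hPm1⟩ := C.locate_final hy0 (s0Of (Dx x)) hyT hres
  rw [← hdh] at hdm
  have hgap := C.gap_le m
  have hG : C.G ≤ (Dx x).size + 2 := (G_le hD hD4 Tv (2 * x.length + 30)).2
  have hbud := Efin_budget hD hD4 Tv (2 * x.length + 30)
  have hη0 := C.η_nonneg
  have hE0 := C.Efin_nonneg (s0Of (Dx x)) Tv (2 * MOf (Dx x) Tv)
  have hsmall : C.Efin (s0Of (Dx x)) Tv (2 * MOf (Dx x) Tv) + 2 * C.η ≤ 1 / 1024 := by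
    refine hbud.trans ?_
    apply div_le_div_of_nonneg_left (by norm_num) (by norm_num)
    have : (1 : ℝ) ≤ (2 : ℝ) ^ (2 * x.length + 30) := one_le_pow₀ (by norm_num)
    have h := mul_le_mul_of_nonneg_left this (show (0 : ℝ) ≤ 1024 by norm_num)
    rw [mul_one] at h
    exact h
  have hlow : (y : ℝ) - ((Dx x).size + 3) < dh := by
    rw [abs_le] at hdm
    linarith [hdm.1]
  -- to integers
  have hsize : (Dx x).size ≤ x.length + 3 := size_Dof_le x
  have hyv : (y : ℚ) * Nn = v := by rw [hy]; field_simp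
  constructor
  · -- `⌈N d̂⌉ ≤ v`
    have hle : (Nn : ℚ) * dh ≤ (v : ℚ) := by
      calc (Nn : ℚ) * dh ≤ Nn * y := mul_le_mul_of_nonneg_left hup hNq.le
        _ = v := by rw [mul_comm]; exact hyv
    have : ⌈(Nn : ℚ) * dh⌉ ≤ (v : ℤ) := Int.ceil_le.mpr (by rw [Int.cast_natCast]; exact hle)
    linarith
  · -- `v − ⌈N d̂⌉ ≤ v − N d̂ < N (size D + 3) < 2^{3|x|+31}`
    have h1 : (v : ℝ) - ((⌈(Nn : ℚ) * dh⌉ : ℤ) : ℝ) < (Nn : ℝ) * ((Dx x).size + 3) := by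
      have hc0 : (((Nn : ℚ) * dh : ℚ) : ℝ) ≤ (((⌈(Nn : ℚ) * dh⌉ : ℤ) : ℚ) : ℝ) := Rat.cast_le.mpr (Int.le_ceil _)
      have hc : (Nn : ℝ) * ((dh : ℚ) : ℝ) ≤ ((⌈(Nn : ℚ) * dh⌉ : ℤ) : ℝ) := by
        simpa only [Rat.cast_mul, Rat.cast_natCast, Rat.cast_intCast] using hc0
      have hyr : ((y : ℚ) : ℝ) = (v : ℝ) / Nn := by rw [hy]; push_cast; rfl
      have hyv' : ((y : ℚ) : ℝ) * Nn = v := by rw [hyr]; field_simp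
      have key : (v : ℝ) - (Nn : ℝ) * ((dh : ℚ) : ℝ) < (Nn : ℝ) * (((Dx x).size : ℝ) + 3) := by
        have e1 : (v : ℝ) - (Nn : ℝ) * ((dh : ℚ) : ℝ) = (((y : ℚ) : ℝ) - ((dh : ℚ) : ℝ)) * Nn := by rw [← hyv']; ring
        have e2 : (Nn : ℝ) * (((Dx x).size : ℝ) + 3) = ((((Dx x).size : ℝ) + 3)) * Nn := by ring
        rw [e1, e2]
        exact mul_lt_mul_of_pos_right (by linarith) hNr
      linarith
    have h2' : (Nn : ℝ) * ((Dx x).size + 3) ≤ (2 : ℝ) ^ (3 * x.length + 31) := by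
      rw [hNn, hallgrenW_N q x]
      have hs : ((Dx x).size : ℝ) + 3 ≤ (2 : ℝ) ^ (x.length + 3) := by
        have : ((Dx x).size : ℝ) + 3 ≤ x.length + 6 := by exact_mod_cast (show (Dx x).size + 3 ≤ x.length + 6 by omega)
        have h' : ((x.length + 6 : ℕ) : ℝ) ≤ (2 : ℝ) ^ (x.length + 3) := by
          have : x.length + 6 ≤ 2 ^ (x.length + 3) := by
            have := Nat.lt_two_pow_self (n := x.length); calc x.length + 6 ≤ 2 ^ x.length + 6 := by omega
              _ ≤ 2 ^ x.length * 8 := by have : 1 ≤ 2 ^ x.length := Nat.one_le_two_pow; omega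
              _ = 2 ^ (x.length + 3) := by ring
          exact_mod_cast this
        push_cast at h'; linarith
      calc (2 : ℝ) ^ (2 * x.length + 28) * (((Dx x).size : ℝ) + 3) ≤ (2 : ℝ) ^ (2 * x.length + 28) * (2 : ℝ) ^ (x.length + 3) :=
            mul_le_mul_of_nonneg_left hs (by positivity)
        _ = (2 : ℝ) ^ (3 * x.length + 31) := by rw [← pow_add]; ring_nf
    have : (v : ℝ) - ((⌈(Nn : ℚ) * dh⌉ : ℤ) : ℝ) < (2 : ℝ) ^ (3 * x.length + 31) := by linarith
    exact_mod_cast this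

/-- **Table values on the reachable range are genuine.** [cite: Jozsa2003, §10 Prop. 36] -/
theorem genuine_tabVal {v : ℕ} (hv : ((v : ℝ) / (hallgrenW q).N x) ≤ (2 : ℝ) ^ Tx q x * (7 / 8)) :
    Genuine x (tabVal q x v) := by
  obtain ⟨a0, a1, b0, b1⟩ := label_bounds q hsf h2 v
  obtain ⟨c0, c1⟩ := offset_bounds q hsf h2 hv
  refine ⟨a0.le, a1, b0.le, b1, ?_⟩
  rw [abs_of_nonneg c0]
  refine c1.trans_le ?_
  unfold offW
  exact pow_le_pow_right₀ (by norm_num) (by omega)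

/-! ### The blurred table of a block length and the level-set relation -/

omit hsf h2 in
/-- `2^L/N ≤ 2^T · 7/8` for block lengths `L ≤ T`. [folklore] -/
theorem pow_div_N_le {L : ℕ} (hL : L ≤ Tx q x) {v : ℕ} (hv : v ≤ 2 ^ L) :
    ((v : ℝ) / (hallgrenW q).N x) ≤ (2 : ℝ) ^ Tx q x * (7 / 8) := by
  have hN := hallgrenW_N q x
  have hN4096 : (4096 : ℝ) ≤ (hallgrenW q).N x := by exact_mod_cast hallgrenW_N_ge q x
  rw [div_le_iff₀ (by linarith)]
  have hvr : (v : ℝ) ≤ (2 : ℝ) ^ L := by exact_mod_cast hv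
  have hLT : (2 : ℝ) ^ L ≤ (2 : ℝ) ^ Tx q x := pow_le_pow_right₀ (by norm_num) hL
  nlinarith [pow_pos (show (0 : ℝ) < 2 by norm_num) (Tx q x)]

/-- **The blurred gap table of block length `L`**: the input's cycle with grid `N`, the walk
parameters of the input, and `V = 2^L − 1`. [cite: Jozsa2003, §10 Prop. 36] -/
def blurredL {L : ℕ} (hL : L ≤ Tx q x) : BlurredGapTable (ℤ × ℤ) :=
  (cycX q hsf h2).blurred (N := (hallgrenW q).N x) (lt_of_lt_of_le (by norm_num) (hallgrenW_N_ge q x))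
    (s₀ := (hallgrenW q).s₀ x) (T := Tx q x) (M := (hallgrenW q).M x) (V := (2 ^ L : ℕ) - 1)
    (by
      refine reach_ok' (goodD_Dof hsf h2).1 (goodD_Dof hsf h2).2 (Tx q x) _ ?_
      have h := pow_div_N_le q hL (le_refl (2 ^ L))
      refine le_trans ?_ h
      push_cast
      exact div_le_div_of_nonneg_right (by linarith) (by positivity))
    (res_ok (goodD_Dof hsf h2).1 (goodD_Dof hsf h2).2 (Tx q x) _)

/-- On `[0, 2^L)` the blurred table is the integer table. [folklore] -/
theorem blurredL_FN {L : ℕ} (hL : L ≤ Tx q x) {v : ℕ} (hv : v < 2 ^ L) :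
    (blurredL q hsf h2 hL).FN v = tabVal q x v := by
  have hN : 0 < (hallgrenW q).N x := lt_of_lt_of_le (by norm_num) (hallgrenW_N_ge q x)
  unfold BlurredGapTable.FN blurredL
  rw [(cycX q hsf h2).blurred_F_of_mem _ _ _ (by positivity)
    (by have h' : v + 1 ≤ 2 ^ L := hv; have h'' := (Nat.cast_le (α := ℤ)).mpr h'; push_cast at h'' ⊢; linarith)]
  unfold tabVal
  rw [hallgrenOps.tableI_eq_table ((hallgrenW q).dOf x) hN, ← cycX_toWalkData q hsf h2]
  rfl

/-- **The compact table code separates exactly the level sets of the blurred table** on `[0, 2^L)`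
(hypothesis `hrel` of the per-unit Fourier-sampling bound). [cite: Jozsa2003, §10 Prop. 36] -/
theorem tabH_eq_iff {L : ℕ} (hL : L ≤ Tx q x) {v v' : ℕ} (hv : v < 2 ^ L) (hv' : v' < 2 ^ L) :
    tabH q x v = tabH q x v' ↔ (blurredL q hsf h2 hL).FN v = (blurredL q hsf h2 hL).FN v' := by
  rw [blurredL_FN q hsf h2 hL hv, blurredL_FN q hsf h2 hL hv']
  constructor
  · exact tabH_inj (genuine_tabVal q hsf h2 (pow_div_N_le q hL hv.le)) (genuine_tabVal q hsf h2 (pow_div_N_le q hL hv'.le))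
  · intro h; unfold tabH; rw [h]

end HallgrenGiantStep

end Literature.Computability.Cryptography

end
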